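import Mathlib
import HarnessLib
import Summits.Schanuel.Schanuel.Theses.AdelicLogSector

/-!
# Line `birth` — BC3 skeleton for the crux `FermatQuotientGenericity` (stmt-Schanuel-7089)

Route `AdelicLogSector` (route-Schanuel-AdelicLogSector), crux (rank 3) GENERICITY:
for distinct primes `ℓ₁,…,ℓ_r` and every nonzero `Q ∈ ℤ[X₁,…,X_r]` there are infinitely many primes `p`
with `Q(q_p(ℓ₁),…,q_p(ℓ_r)) ≢ 0 (mod p)`, `q_p(ℓ) = (ℓ^{p−1} − 1)/p` the Fermat quotient.

Notation (informal; the Lean below is fully unfolded, in the route's own spelling of `q_p`):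
* `NZ(Q) := {p prime : Q(q_p ℓ) ≢ 0 (mod p)}` — the non-vanishing set of `Q`;
* for an affine-linear integer form `L = Σ aᵢXᵢ + c` with `a ≠ 0`:
  `Z(L) := {p prime : Σ aᵢ q_p(ℓᵢ) + c ≡ 0 (mod p)}` — a HYPERPLANE EVENT (by Eisenstein's logarithm
  property, route support `FermatQuotientHom`, `Z(Σ aᵢXᵢ)` is the set of Wieferich primes of the rational
  base `Π ℓᵢ^{aᵢ}`);
* a set `E` of primes is THIN if `Σ_{p ∈ E} 1/p < ∞` (Lean: `Summable (E.indicator fun n ↦ 1/n)`), THICK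
  otherwise. Thin sets form an ideal containing the finite sets; the set of all primes is thick (Euler,
  `Nat.Primes.not_summable_one_div`).

THE LINE — separate the DEGREE-ONE (Wieferich-type) phenomena from the NONLINEAR generic behaviour, in the
only currency in which the two halves can be glued back at a COMMON prime: an ideal of small sets of primes.
(The naive split "genericity for linear Q" ∧ "genericity for Q without linear factors" does NOT compose —
`NZ(L·R) = NZ(L) ∩ NZ(R)` needs one prime serving both — and its second half absorbs the first by an
auxiliary factor; the route's foreseen split `GenericityDegreeOne → GenericityHigherDegree` has the same
defect: the higher-degree half alone is the crux via `Q ↦ Q²`. Measuring the exceptional sets repairs it.)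
* `stub_hyperplaneThin` (OPEN, degree one; abc-flavoured but beyond Silverman): every hyperplane event is
  thin — `Σ_{p ∈ Z(L)} 1/p < ∞` for every affine-linear `L` with `a ≠ 0`. Heuristic: `q_p(ℓ)` behaves like a
  uniform residue, `P(p ∈ Z(L)) ≈ 1/p`, so `E|Z(L) ∩ [1,X]| ≈ log log X` and `E Σ_{Z(L)} 1/p = Σ 1/p² < ∞`;
  data: base-2 Wieferich primes below `4·10¹²` are `{1093, 3511}` (doi:10.1090/s0025-5718-97-00791-6), and the
  refuter's run on this item (evidence `fq_local_1e7.json`) found 0–3 exceptional primes `≤ 10⁷` per form.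
  By Eisenstein's homomorphism `Z(Σ aᵢXᵢ)` is the Wieferich set of the rational base `b = Π ℓᵢ^{aᵢ} ≠ ±1`, so
  the stub says "the non-Wieferich primes of every such base have divergent reciprocal sum" and ALONE gives the
  crux for every `Q` that is a product of affine-linear forms — in particular its degree-one rung (open;
  even `∞`-many non-Wieferich primes per base is known only under abc, Silverman1988).
  Why it might fail / why it is hard: no method controls `q_p(ℓ) mod p` for FIXED `ℓ` and varying `p`
  (all known distribution results — Heath-Brown, Shparlinski — fix `p` and vary the base); a thick
  hyperplane event would be a spectacular arithmetic bias but contradicts nothing known.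
* `stub_thickOffHyperplanes` (OPEN, the nonlinear content; load-bearing for `deg Q ≥ 2`): for every
  nonzero `Q` there are finitely many hyperplane events `Z(L₁),…,Z(L_m)` such that
  `NZ(Q) ∪ Z(L₁) ∪ … ∪ Z(L_m)` is THICK. For `Q` a product of linear forms this is trivial (take its own
  factors: the union is all large primes); for `Q` with no rational linear factor it says `NZ(Q)` is thick
  modulo hyperplane events — heuristically `NZ(Q)` has relative density one (`P(p ∉ NZ(Q)) ≤ deg Q/p`). The
  first genuinely open instance is the route's 2×2 rung `Q = X₁X₂ − X₃X₄` at `(2,3,5,7)` (no exceptional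
  prime `≤ 10⁷`, evidence `fq_local_1e7.json`). Why it might fail: an approximate identity — `Q(q_p ℓ) ≡ 0`
  on a co-thin set of primes off the hyperplane events — i.e. a hidden `p`-derivation-like structure on `ℤ`
  (in `𝔽_q[t]` one has `q_P(f) ≡ c_P · f′/f (mod P)` with `c_P = (t^{|P|} − t)/P ≢ 0`, so the
  Fermat-quotient vector of fixed polynomials is, projectively, the reduction mod `P` of the FIXED vector
  `(ℓᵢ′/ℓᵢ)` and homogeneous genericity fails there as soon as `r ≥ 3` (`trdeg 𝔽_q(t) = 1`); so any proof
  must use the absence of a derivation on `ℤ` — Buium2015's `p`-derivation `δ_p`, whose first digit IS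
  `q_p`, is the nearest object, and an `𝔽₁`-style hidden derivation is exactly what would kill the stub).
* Composition (sorry-free, standard axioms): if `Q(q_p ℓ) ≡ 0` for all primes `p ≥ p₀` then `NZ(Q)` is
  finite, hence thin; each `Z(L_j)` is thin by the first stub; a finite union of thin sets is thin
  (`summable_indicator_union_iUnion`, a union bound on indicators) — contradicting the second stub.
  `FermatQuotientGenericity_of : Stmt.stub_hyperplaneThin → Stmt.stub_thickOffHyperplanes →
  FermatQuotientGenericity` is that proof; `FermatQuotientGenericity_proof : FermatQuotientGenericity` plugs in
  the two registered (sorried) stubs and thereby compiler-checks that the `Stmt.` copies agree with them.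

Logical position of the stubs. Neither stub is comparable to the crux or to the summit by a cheap
implication (BC3 probes, `maxHeartbeats 400000`: `stub → FermatQuotientGenericity` with the crux name
folded and unfolded, and `stub → Schanuel`, each by `first | exact? | simpa [stub] | (unfold stub; simpa) |
aesop` and again tactic by tactic — all six probes FAIL, 0 successes in 14 tactic runs: `exact?` "could not
close the goal" (→ crux) resp. times out enumerating the tree's `… → Schanuel` lemmas, `simpa` fails, `aesop`
ends "failed to prove the goal after exhaustive search" with `⊢ FermatQuotientGenericity` / `⊢ Schanuel`
open, or the unfolded goals exhaust the heartbeats in `whnf`; files `bc/probes.lean`, `bc/probes2.lean` of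
the registrar session, verdicts in its NOTES.md):
`stub_hyperplaneThin` alone yields the crux only for LINEAR `Q` (complement of a thin set of primes is
infinite); `stub_thickOffHyperplanes` alone yields nothing (its escape hatch — the hyperplane events — is
closed only by the first stub); conversely the crux implies neither (both are measure-theoretic
strengthenings of their halves: thin/thick instead of finite/infinite — the price of gluing at a common
prime, and the form in which sieve, moment and averaging methods speak about exceptional primes).
Neither stub mentions `exp`, `log` or transcendence degree, so neither is the summit in costume.

Shape (skeleton audit by-name rule, as in the tree's other `Lines/birth.lean` files):
* `Stmt.stub_…` — the two stub statements as precise `Prop`s, named like the stubs (admissible hypothesis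
  heads for the by-name audit of `FermatQuotientGenericity_of`);
* `stub_…` — the same statements, fully unfolded, as sorried theorems (the REGISTERED stubs; `sorry` occurs
  nowhere else: sorry count 2 = stub count);
* `summable_indicator_union_iUnion` — the union bound (sorry-free infrastructure);
* `FermatQuotientGenericity_of` — the composition, real proof; `FermatQuotientGenericity_proof` — the crux BY
  NAME modulo exactly the two registered stubs.
Both stubs are DEF-FREE beyond Mathlib, so each can land as
`Theorems/AdelicLogSectorFermatQuotientGenericity<Stub>.lean` with `--supports stmt-Schanuel-7089`.

Disproof used. None exists: `Cruxes/FermatQuotientGenericity/` had no workfiles (no `Disproof.lean`, no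
`Negative/` lemma, no crux ideas) at registration (2026-08-17), so there is no `_false_without_` obstruction
to honour; the item's refuter notes (route-review 2026-08-15) record no identity among Fermat quotients of
fixed bases and a clean cheapest-falsifier run. Hardest stub: `stub_thickOffHyperplanes` (it carries the
2×2 rung); `stub_hyperplaneThin` is the Wieferich-type half.
Sources: Silverman1988; doi:10.1090/s0025-5718-97-00791-6 (Crandall–Dilcher–Pomerance); Buium2015;
Waldschmidt2004; route file `Theses/AdelicLogSector.lean` (items 7089, 7096, 7097).
-/

-- `Summit.<Summit>.<Problem>`: for the single-conjunct summit `Schanuel` the duplicate `Schanuel.Schanuel` is mandated.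
set_option linter.dupNamespace false
set_option linter.unusedVariables false

namespace Summit.Schanuel.Schanuel.Cruxes.FermatQuotientGenericity.Birth

open Summit.Schanuel.Schanuel.Theses.AdelicLogSector

/-! ## The two stub statements (`Stmt.stub_*`, named like the registered stubs) -/

/-- STUB 1 statement — HYPERPLANE EVENTS ARE THIN (open; the degree-one / Wieferich-type half).
For distinct primes `ℓᵢ`, an integer vector `a ≠ 0` and `c ∈ ℤ`, the primes `p` with
`Σᵢ aᵢ q_p(ℓᵢ) + c ≡ 0 (mod p)` have convergent reciprocal sum. [Silverman1988,
doi:10.1090/s0025-5718-97-00791-6, Buium2015] -/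
def Stmt.stub_hyperplaneThin : Prop :=
  ∀ (r : ℕ) (ℓ : Fin r → ℕ), (∀ i, (ℓ i).Prime) → Function.Injective ℓ →
    ∀ (a : Fin r → ℤ) (c : ℤ), a ≠ 0 →
      Summable ({p : ℕ | p.Prime ∧
          (∑ i, (a i : ZMod p) * ((((ℓ i) ^ (p - 1) - 1) / p : ℕ) : ZMod p)) + (c : ZMod p) = 0}.indicator
        fun n : ℕ => (1 : ℝ) / n)

/-- STUB 2 statement — THICK GENERICITY OFF FINITELY MANY HYPERPLANE EVENTS (open; the nonlinear half,
load-bearing). For distinct primes `ℓᵢ` and a nonzero `Q ∈ ℤ[X]` there are finitely many affine-linear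
forms `L_j = Σᵢ a_{ji}Xᵢ + c_j` (`a_j ≠ 0`) such that the primes at which `Q(q_p ℓ) ≢ 0` OR some
`L_j(q_p ℓ) ≡ 0` have divergent reciprocal sum. [Silverman1988, Buium2015, Waldschmidt2004] -/
def Stmt.stub_thickOffHyperplanes : Prop :=
  ∀ (r : ℕ) (ℓ : Fin r → ℕ), (∀ i, (ℓ i).Prime) → Function.Injective ℓ →
    ∀ Q : MvPolynomial (Fin r) ℤ, Q ≠ 0 →
      ∃ (m : ℕ) (a : Fin m → Fin r → ℤ) (c : Fin m → ℤ), (∀ j, a j ≠ 0) ∧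
        ¬ Summable (({p : ℕ | p.Prime ∧
              MvPolynomial.aeval (fun i => ((((ℓ i) ^ (p - 1) - 1) / p : ℕ) : ZMod p)) Q ≠ 0} ∪
            ⋃ j : Fin m, {p : ℕ | p.Prime ∧
              (∑ i, (a j i : ZMod p) * ((((ℓ i) ^ (p - 1) - 1) / p : ℕ) : ZMod p)) + (c j : ZMod p) = 0}).indicator
          fun n : ℕ => (1 : ℝ) / n)

/-! ## Registered stubs (the ONLY sorries of this file; statements fully unfolded, registered verbatim) -/

/-- Registered stub 1 = `Stmt.stub_hyperplaneThin`: every hyperplane event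
`Z(Σ aᵢXᵢ + c) = {p : Σ aᵢ q_p(ℓᵢ) + c ≡ 0 (mod p)}` (`a ≠ 0`) of the Fermat-quotient vectors of fixed
distinct primes is thin (`Σ_{p ∈ Z} 1/p < ∞`). Open; implies divergence of `Σ 1/p` over the non-Wieferich
primes of every rational base `≠ ±1` (r = 1 rung of the crux; `∞`-many known only under abc). Size L. -/
theorem stub_hyperplaneThin :
    ∀ (r : ℕ) (ℓ : Fin r → ℕ), (∀ i, (ℓ i).Prime) → Function.Injective ℓ →
      ∀ (a : Fin r → ℤ) (c : ℤ), a ≠ 0 →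
        Summable ({p : ℕ | p.Prime ∧
            (∑ i, (a i : ZMod p) * ((((ℓ i) ^ (p - 1) - 1) / p : ℕ) : ZMod p)) + (c : ZMod p) = 0}.indicator
          fun n : ℕ => (1 : ℝ) / n) := by
  sorry

/-- Registered stub 2 = `Stmt.stub_thickOffHyperplanes`: for nonzero `Q`, the non-vanishing set `NZ(Q)`
together with finitely many hyperplane events is thick (`Σ 1/p = ∞`). Trivial for products of linear
forms; open for `Q` without rational linear factors (first instance: `X₁X₂ − X₃X₄` at `(2,3,5,7)`).
Size L–XL (it is where the nonlinear crux lives). -/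
theorem stub_thickOffHyperplanes :
    ∀ (r : ℕ) (ℓ : Fin r → ℕ), (∀ i, (ℓ i).Prime) → Function.Injective ℓ →
      ∀ Q : MvPolynomial (Fin r) ℤ, Q ≠ 0 →
        ∃ (m : ℕ) (a : Fin m → Fin r → ℤ) (c : Fin m → ℤ), (∀ j, a j ≠ 0) ∧
          ¬ Summable (({p : ℕ | p.Prime ∧
                MvPolynomial.aeval (fun i => ((((ℓ i) ^ (p - 1) - 1) / p : ℕ) : ZMod p)) Q ≠ 0} ∪
              ⋃ j : Fin m, {p : ℕ | p.Prime ∧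
                (∑ i, (a j i : ZMod p) * ((((ℓ i) ^ (p - 1) - 1) / p : ℕ) : ZMod p)) +
                  (c j : ZMod p) = 0}).indicator
            fun n : ℕ => (1 : ℝ) / n) := by
  sorry

/-! ## Sorry-free infrastructure: a finite union of thin sets is thin -/

/-- Union bound for reciprocal sums: if `S` and each of finitely many `H j` have convergent `Σ 1/n`, so has
`S ∪ ⋃ j, H j` (indicator of the union ≤ sum of the indicators, values nonnegative). [folklore] -/
theorem summable_indicator_union_iUnion {ι : Type*} [Fintype ι] {S : Set ℕ} {H : ι → Set ℕ}
    (hS : Summable (S.indicator fun n : ℕ => (1 : ℝ) / n))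
    (hH : ∀ j, Summable ((H j).indicator fun n : ℕ => (1 : ℝ) / n)) :
    Summable ((S ∪ ⋃ j, H j).indicator fun n : ℕ => (1 : ℝ) / n) := by
  have hf : ∀ k : ℕ, (0 : ℝ) ≤ 1 / (k : ℝ) := fun k => by positivity
  have hsum : Summable (fun n => S.indicator (fun n : ℕ => (1 : ℝ) / n) n +
      ∑ j, (H j).indicator (fun n : ℕ => (1 : ℝ) / n) n) :=
    hS.add (summable_sum fun j _ => hH j)
  refine Summable.of_nonneg_of_le (fun n => Set.indicator_nonneg (fun k _ => hf k) n) (fun n => ?_) hsum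
  have h0 : (0 : ℝ) ≤ ∑ j, (H j).indicator (fun n : ℕ => (1 : ℝ) / n) n :=
    Finset.sum_nonneg fun j _ => Set.indicator_nonneg (fun k _ => hf k) n
  have h1 : (0 : ℝ) ≤ S.indicator (fun n : ℕ => (1 : ℝ) / n) n := Set.indicator_nonneg (fun k _ => hf k) n
  by_cases hn : n ∈ S ∪ ⋃ j, H j
  · rw [Set.indicator_of_mem hn]
    rcases hn with hnS | hnH
    · rw [Set.indicator_of_mem hnS]
      linarith
    · rw [Set.mem_iUnion] at hnH
      obtain ⟨j, hj⟩ := hnH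
      have hle : (1 : ℝ) / (n : ℝ) ≤ ∑ j', (H j').indicator (fun n : ℕ => (1 : ℝ) / n) n := by
        have key := Finset.single_le_sum (f := fun j' => (H j').indicator (fun n : ℕ => (1 : ℝ) / n) n)
          (fun j' _ => Set.indicator_nonneg (fun k _ => hf k) n) (Finset.mem_univ j)
        simpa [Set.indicator_of_mem hj] using key
      linarith
  · rw [Set.indicator_of_notMem hn]
    linarith

/-! ## The composition: stub statements ⟹ the crux (sorry-free, standard axioms) -/

/-- **The real composition.** From the two stub statements (as named hypotheses) the crux follows: if
`Q(q_p ℓ) ≡ 0 (mod p)` for every prime `p ≥ p₀`, then `NZ(Q) ⊆ {n < p₀}` is finite, hence thin; the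
hyperplane events `Z(L_j)` supplied by `stub_thickOffHyperplanes` are thin by `stub_hyperplaneThin`; so
`NZ(Q) ∪ ⋃ⱼ Z(L_j)` is thin (`summable_indicator_union_iUnion`) — contradicting its thickness. [folklore] -/
theorem FermatQuotientGenericity_of :
    Stmt.stub_hyperplaneThin → Stmt.stub_thickOffHyperplanes → FermatQuotientGenericity := by
  intro hThin hThick
  unfold Stmt.stub_hyperplaneThin at hThin
  unfold Stmt.stub_thickOffHyperplanes at hThick
  unfold FermatQuotientGenericity
  intro r ℓ hℓ hinj Q hQ p₀
  by_contra hcon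
  -- hcon : ¬ ∃ p, p₀ ≤ p ∧ p.Prime ∧ Q(q_p ℓ) ≠ 0, i.e. Q(q_p ℓ) = 0 for every prime p ≥ p₀
  have hvan : ∀ p : ℕ, p₀ ≤ p → p.Prime →
      MvPolynomial.aeval (fun i => ((((ℓ i) ^ (p - 1) - 1) / p : ℕ) : ZMod p)) Q = 0 := by
    intro p hp hpp
    by_contra hne
    exact hcon ⟨p, hp, hpp, hne⟩
  obtain ⟨m, a, c, ha, hthick⟩ := hThick r ℓ hℓ hinj Q hQ
  apply hthick
  refine summable_indicator_union_iUnion ?_ (fun j => hThin r ℓ hℓ hinj (a j) (c j) (ha j))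
  refine summable_of_ne_finset_zero (s := Finset.range p₀) fun n hn => ?_
  rw [Finset.mem_range, not_lt] at hn
  apply Set.indicator_of_notMem
  intro hmem
  exact hmem.2 (hvan n hn hmem.1)

/-- **THE skeleton theorem** — the crux `FermatQuotientGenericity` BY NAME from the two registered stubs
via the sorry-free composition `FermatQuotientGenericity_of` (compiler-checks that the `Stmt.` copies and
the registered stub statements agree; `sorry` enters only through `stub_hyperplaneThin` and
`stub_thickOffHyperplanes`). [folklore] -/
theorem FermatQuotientGenericity_proof : FermatQuotientGenericity :=
  FermatQuotientGenericity_of stub_hyperplaneThin stub_thickOffHyperplanes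

end Summit.Schanuel.Schanuel.Cruxes.FermatQuotientGenericity.Birth
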